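import Summits.AtomisticToContinuum.HydrodynamicLimit.Theorems.AntiMazurCoboundariesCellForecastPressureDecayEnskogObjects
import Literature.Analysis.FluidPDE.HardSphereCollisionRecord
import HarnessLib

/-!
# S2d · kinematic assembly, piece 7: the kinetic energy of a collision-closed group of spheres
# (registered sub-goal `stub_kinematicAssembly_clusterEnergy` of stub `stub_kinematicAssembly`, crux line
# `enskog-compensator-martingale`, crux `CellForecastPressureDecay`, stmt-AtomisticToContinuum-13915)

The error term of the equal-time Enskog kinematics (`KinematicRates σ`, stub S2d) is carried by the spheres whose
collision cluster in the slab `[0, Δ]` has at least three elements. Charging such a cluster to a STATIC event of the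
initial data requires a bound on the speeds — hence the displacements — of its spheres during the slab in terms of
the INITIAL data of the cluster alone: energy is exchanged only in collisions, and a group of spheres `B` that is
closed under the collisions of a time window (every colliding pair of the window lies inside `B` or outside `B`)
conserves its kinetic energy `∑_{q ∈ B} ‖v_q‖²` on that window. This file proves, for a hard-sphere trajectory in any
geometry (`IsHardSphereTrajectory`; no continuity of translations is needed, as for the total energy in
`HardSphereDynamicsProofs`):

* `groupEnergy_collidePair_of_mem`, `groupEnergy_collidePair_of_not_mem` — an elastic jump inside / outside `B`
  preserves the energy of `B`;
* `groupEnergy_eq_of_closed` — **conservation of the energy of a collision-closed group** on `[a, b]`;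
* `norm_vel_le_of_closed` — hence every sphere of `B` has speed `≤ (∑_{q ∈ B} ‖v_q(a)‖²)^{1/2}` on `[a, b]`;
* `stub_kinematicAssembly_clusterEnergy` (registered) — the same for the whole-cell Euclidean flow of the line's
  objects on its good set, window `[0, Δ]`.

References: Gallagher–Saint-Raymond–Texier 2013, §1.1 and §4.1 (elastic collisions conserve the kinetic energy of
the colliding pair); O. E. Lanford, *Time evolution of large classical systems* (1975), §3 (cluster dynamics).
-/

noncomputable section

open MeasureTheory ProbabilityTheory Set Filter Topology
open scoped ENNReal BigOperators InnerProductSpace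
open Literature.Analysis.FluidPDE Literature.MathematicalPhysics.KineticTheory

namespace Summit.AtomisticToContinuum.HydrodynamicLimit.Theorems.EnskogCompensator

section Trajectory

variable {d : Type*} [Fintype d] {X : Type*} {N : ℕ} {G : Geometry d X} {ε : ℝ}

/-- The energy of a group only depends on the velocities of its members. [folklore] -/
theorem groupEnergy_congr (B : Finset (Fin N)) {z z' : Config N d X} (h : ∀ q ∈ B, (z q).2 = (z' q).2) :
    ∑ q ∈ B, ‖(z q).2‖ ^ 2 = ∑ q ∈ B, ‖(z' q).2‖ ^ 2 :=
  Finset.sum_congr rfl fun q hq => by rw [h q hq]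

/-- An elastic jump of a pair INSIDE the group preserves the energy of the group. [cite: GST2013, §1.1] -/
theorem groupEnergy_collidePair_of_mem (B : Finset (Fin N)) {i j : Fin N} (hij : i ≠ j) (hi : i ∈ B) (hj : j ∈ B)
    (z : Config N d X) :
    ∑ q ∈ B, ‖(collidePair G i j z q).2‖ ^ 2 = ∑ q ∈ B, ‖(z q).2‖ ^ 2 := by
  classical
  have hjB : j ∈ B.erase i := Finset.mem_erase.2 ⟨hij.symm, hj⟩
  rw [← Finset.add_sum_erase _ _ hi, ← Finset.add_sum_erase _ _ hjB,
    ← Finset.add_sum_erase _ _ hi, ← Finset.add_sum_erase _ _ hjB, ← add_assoc, ← add_assoc]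
  congr 1
  · rw [collidePair_apply_left hij, collidePair_apply_right]
    exact norm_sq_reflectVel_fst_add_norm_sq_reflectVel_snd _ _
  · refine Finset.sum_congr rfl fun q hq => ?_
    simp only [Finset.mem_erase] at hq
    rw [collidePair_apply_of_ne hq.2.1 hq.1]

/-- An elastic jump of a pair OUTSIDE the group does not touch the group. [folklore] -/
theorem groupEnergy_collidePair_of_not_mem (B : Finset (Fin N)) {i j : Fin N} (hi : i ∉ B) (hj : j ∉ B)
    (z : Config N d X) :
    ∑ q ∈ B, ‖(collidePair G i j z q).2‖ ^ 2 = ∑ q ∈ B, ‖(z q).2‖ ^ 2 :=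
  groupEnergy_congr B fun q hq => by
    have hqi : q ≠ i := fun h => hi (h ▸ hq)
    have hqj : q ≠ j := fun h => hj (h ▸ hq)
    rw [collidePair_apply_of_ne hqi hqj]

variable [TopologicalSpace X] {γ : ℝ → Config N d X}

/-- On a collision-free stretch `[t, u)` the energy of any group is constant (free flight). [folklore] -/
theorem groupEnergy_eq_of_mem_Ico (h : IsHardSphereTrajectory G ε N γ) (B : Finset (Fin N)) {t u τ : ℝ}
    (hfree : ∀ s ∈ Ioo t u, s ∉ collisionTimes G ε γ) (hτ : τ ∈ Ico t u) :
    ∑ q ∈ B, ‖(γ τ q).2‖ ^ 2 = ∑ q ∈ B, ‖(γ t q).2‖ ^ 2 :=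
  groupEnergy_congr B fun q _ => by rw [h.eq_freeFlight_of_Ioo_free hfree hτ, freeFlight_apply]

/-- To the left of a time `t` at which every colliding pair lies inside or outside `B`: if `(τ, t)` is
collision-free then the energy of `B` at `t` is that at `τ` (the left limit has the velocities of `γ τ`, and the
jump at `t`, if any, preserves the energy of `B`). [cite: GST2013, §1.1] -/
theorem groupEnergy_eq_of_Ioo_free (h : IsHardSphereTrajectory G ε N γ) (B : Finset (Fin N)) {τ t : ℝ}
    (hτt : τ < t) (hfree : ∀ s ∈ Ioo τ t, s ∉ collisionTimes G ε γ)
    (hclosed : ∀ i j : Fin N, i ≠ j → γ t ∈ contactSet G N ε i j → (i ∈ B ↔ j ∈ B)) :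
    ∑ q ∈ B, ‖(γ t q).2‖ ^ 2 = ∑ q ∈ B, ‖(γ τ q).2‖ ^ 2 := by
  by_cases ht : t ∈ collisionTimes G ε γ
  · obtain ⟨i, j, hij, hc⟩ := ht
    obtain ⟨-, zl, hzl, -, heq⟩ := h.binary t i j hij hc
    have hvel : ∀ k, (zl k).2 = (γ τ k).2 := fun k => by
      have h1 : Tendsto (fun s => (γ s k).2) (𝓝[<] t) (𝓝 (zl k).2) := by
        have hcont : Continuous fun z : Config N d X => (z k).2 := by fun_prop
        exact (hcont.tendsto zl).comp hzl
      have h2 : Tendsto (fun s => (γ s k).2) (𝓝[<] t) (𝓝 (γ τ k).2) := by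
        refine tendsto_const_nhds.congr' ?_
        filter_upwards [Ioo_mem_nhdsLT hτt] with s hs
        rw [h.eq_freeFlight_of_Ioo_free hfree ⟨hs.1.le, hs.2⟩]
        rfl
      exact tendsto_nhds_unique h1 h2
    rw [heq]
    by_cases hiB : i ∈ B
    · rw [groupEnergy_collidePair_of_mem B hij hiB ((hclosed i j hij hc).1 hiB) zl]
      exact groupEnergy_congr B fun q _ => hvel q
    · rw [groupEnergy_collidePair_of_not_mem B hiB (fun hjB => hiB ((hclosed i j hij hc).2 hjB)) zl]
      exact groupEnergy_congr B fun q _ => hvel q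
  · refine groupEnergy_congr B fun q _ => ?_
    rw [h.free τ t hτt.le fun s hs => ?_, freeFlight_apply]
    rcases hs.2.eq_or_lt with rfl | hlt
    · exact ht
    · exact hfree s ⟨hs.1, hlt⟩

/-- **Conservation of the energy of a collision-closed group.** If at every time of `(a, b]` every colliding pair
lies inside `B` or outside `B`, then `∑_{q ∈ B} ‖v_q(t)‖²` is constant on `[a, b]`. [cite: GST2013, §1.1] -/
theorem groupEnergy_eq_of_closed (h : IsHardSphereTrajectory G ε N γ) (B : Finset (Fin N)) {a b : ℝ}
    (hclosed : ∀ t ∈ Ioc a b, ∀ i j : Fin N, i ≠ j → γ t ∈ contactSet G N ε i j → (i ∈ B ↔ j ∈ B))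
    {t : ℝ} (ht : t ∈ Icc a b) :
    ∑ q ∈ B, ‖(γ t q).2‖ ^ 2 = ∑ q ∈ B, ‖(γ a q).2‖ ^ 2 := by
  rcases ht.1.eq_or_lt with rfl | hat
  · rfl
  -- the energy of `B`, read through the clamp `s ↦ max a (min s b)`, is locally constant on `ℝ`
  set c : ℝ → ℝ := fun s => max a (min s b) with hc
  set f : ℝ → ℝ := fun s => ∑ q ∈ B, ‖(γ (c s) q).2‖ ^ 2 with hf
  have hab : a ≤ b := ht.1.trans ht.2
  have hca : c a = a := by simp [hc, hab]
  have hct : c t = t := by simp [hc, ht.1, ht.2]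
  have hloc : IsLocallyConstant f := by
    refine (IsLocallyConstant.iff_eventually_eq _).2 fun s => ?_
    rcases lt_or_ge s a with hsa | hsa
    · filter_upwards [eventually_lt_nhds hsa] with y hy
      simp only [hf, hc, max_eq_left (min_le_of_left_le hy.le), max_eq_left (min_le_of_left_le hsa.le)]
    rcases lt_or_ge b s with hbs | hsb
    · filter_upwards [eventually_gt_nhds hbs] with y hy
      simp only [hf, hc, min_eq_right hy.le, min_eq_right hbs.le]
    have hcs : c s = s := by simp [hc, hsa, hsb]
    obtain ⟨s₀, hs₀s, hfreel⟩ := h.exists_Ioo_left_free s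
    obtain ⟨u₀, hsu₀, hfreer⟩ := h.exists_Ioo_right_free s
    have hright : ∀ y, s ≤ y → y < u₀ → f y = f s := by
      intro y hsy hyu
      have hcy : c y ∈ Ico s u₀ :=
        ⟨le_max_of_le_right (le_min hsy hsb), max_lt (lt_of_le_of_lt hsa hsu₀) (lt_of_le_of_lt (min_le_left _ _) hyu)⟩
      simp only [hf, hcs]
      exact groupEnergy_eq_of_mem_Ico h B hfreer hcy
    rcases hsa.eq_or_lt with rfl | has
    · filter_upwards [Ioo_mem_nhds (show a - 1 < a by linarith) hsu₀] with y hy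
      rcases lt_or_ge y a with hya | hay
      · simp only [hf, hc, max_eq_left (min_le_of_left_le hya.le), min_eq_left hab, max_self]
      · exact hright y hay hy.2
    · have hm : max s₀ a < s := max_lt hs₀s has
      filter_upwards [Ioo_mem_nhds hm hsu₀] with y hy
      rcases lt_or_ge y s with hys | hsy
      · have hay : a ≤ y := (le_max_right _ _).trans hy.1.le
        have hcy : c y = y := by simp [hc, hay, hys.le.trans hsb]
        have hs₀y : s₀ < y := (le_max_left _ _).trans_lt hy.1
        simp only [hf, hcy, hcs]
        exact (groupEnergy_eq_of_Ioo_free h B hys (fun τ hτ => hfreel τ ⟨hs₀y.trans hτ.1, hτ.2⟩)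
          (hclosed s ⟨has, hsb⟩)).symm
      · exact hright y hsy hy.2
  have := hloc.apply_eq_of_preconnectedSpace t a
  simpa only [hf, hca, hct] using this

/-- **Speed bound inside a collision-closed group**: every sphere of `B` has, on `[a, b]`, squared speed at most
the initial energy `∑_{q ∈ B} ‖v_q(a)‖²` of the group. [cite: GST2013, §1.1] -/
theorem norm_vel_sq_le_of_closed (h : IsHardSphereTrajectory G ε N γ) (B : Finset (Fin N)) {a b : ℝ}
    (hclosed : ∀ t ∈ Ioc a b, ∀ i j : Fin N, i ≠ j → γ t ∈ contactSet G N ε i j → (i ∈ B ↔ j ∈ B))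
    {t : ℝ} (ht : t ∈ Icc a b) {p : Fin N} (hp : p ∈ B) :
    ‖(γ t p).2‖ ^ 2 ≤ ∑ q ∈ B, ‖(γ a q).2‖ ^ 2 := by
  rw [← groupEnergy_eq_of_closed h B hclosed ht]
  exact Finset.single_le_sum (f := fun q => ‖(γ t q).2‖ ^ 2) (fun q _ => sq_nonneg _) hp

/-- Speed form: `‖v_p(t)‖ ≤ (∑_{q ∈ B} ‖v_q(a)‖²)^{1/2}` for `p ∈ B`, `t ∈ [a, b]`. [cite: GST2013, §1.1] -/
theorem norm_vel_le_of_closed (h : IsHardSphereTrajectory G ε N γ) (B : Finset (Fin N)) {a b : ℝ}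
    (hclosed : ∀ t ∈ Ioc a b, ∀ i j : Fin N, i ≠ j → γ t ∈ contactSet G N ε i j → (i ∈ B ↔ j ∈ B))
    {t : ℝ} (ht : t ∈ Icc a b) {p : Fin N} (hp : p ∈ B) :
    ‖(γ t p).2‖ ≤ Real.sqrt (∑ q ∈ B, ‖(γ a q).2‖ ^ 2) := by
  rw [← Real.sqrt_sq (norm_nonneg _)]
  exact Real.sqrt_le_sqrt (norm_vel_sq_le_of_closed h B hclosed ht hp)

end Trajectory

/-! ## The registered sub-goal: the whole-cell Euclidean flow of the line -/

/-- **Registered sub-goal `stub_kinematicAssembly_clusterEnergy`** (piece of stub `stub_kinematicAssembly`, S2d, of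
the line `enskog-compensator-martingale`): along the whole-cell hard-sphere flow of a good initial datum `z`, a
group of spheres `B` that is closed under the collisions of the slab `(0, Δ]` (every pair in contact at a time of the
slab lies inside `B` or outside `B` — e.g. a collision cluster of the slab) conserves its kinetic energy, so that
every sphere of `B` has speed at most `(∑_{q ∈ B} ‖v_q‖²)^{1/2}` (initial energy of the group) throughout the slab:
the deterministic input of the cluster-size (short-time) estimates of the assembly. [cite: GST2013, §1.1] -/
theorem stub_kinematicAssembly_clusterEnergy : ∀ (σ : ℝ) (n : ℕ) (Ψ : Flows σ) (z : Cell n), z ∈ (Ψ n).good →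
    ∀ (B : Finset (Fin n)) (Δ : ℝ),
      (∀ t ∈ Set.Ioc 0 Δ, ∀ i j : Fin n, i ≠ j →
        (Ψ n).flow t z ∈ contactSet (Euclidean.geometry (Fin 3)) n σ i j → (i ∈ B ↔ j ∈ B)) →
      ∀ t ∈ Set.Icc 0 Δ,
        (∑ q ∈ B, ‖((Ψ n).flow t z q).2‖ ^ 2 = ∑ q ∈ B, ‖(z q).2‖ ^ 2) ∧
        ∀ p ∈ B, ‖((Ψ n).flow t z p).2‖ ≤ Real.sqrt (∑ q ∈ B, ‖(z q).2‖ ^ 2) := by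
  intro σ n Ψ z hz B Δ hclosed t ht
  have htraj := (Ψ n).isTrajectory z hz
  have h0 : (Ψ n).flow 0 z = z := (Ψ n).flow_zero z hz
  have h1 := groupEnergy_eq_of_closed htraj B hclosed ht
  have h2 := fun p (hp : p ∈ B) => norm_vel_le_of_closed htraj B hclosed ht hp
  simp only [h0] at h1 h2
  exact ⟨h1, h2⟩

end Summit.AtomisticToContinuum.HydrodynamicLimit.Theorems.EnskogCompensator

end
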